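import Summits.AnomalousDissipation.AnomalousDissipation.Theorems.BaireTransferDenseLoudDesignerForcesErgodicFrameCurveDeriv
import Summits.AnomalousDissipation.AnomalousDissipation.Theorems.BaireTransferDenseLoudDesignerForcesErgodicFramePreimage
import Summits.AnomalousDissipation.AnomalousDissipation.Theorems.BaireTransferDenseLoudDesignerForcesErgodicModelDefs
import Literature.Analysis.FunctionSpaces.TorusLinearisedNSEnergy
import Literature.Analysis.FunctionSpaces.TorusEnstrophyOrthogonality

/-!
# Frame algebra of the smooth model: states of differences, the `H¹` frame-norm identity and the
# frame curve of `∂ₜu` (tools for the registered stub S6c₂ `stub_modelMixedDerivativeFieldTools`,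
# line ergodic-budget-selection-closing, block N-R of the crux `DenseLoudDesignerForces`)

Summit-side glue over the landed vocabulary (`Hsp`, `rep`, `stateOf`, `ModelFrame`): for the frame
`S = (1 + A)^{-1/2}` of a `ModelFrame` (pinned on the Stokes mode basis by `S (b i) = (1 + m i)^{-1/2} b i`),

* `stateOf_sub'`, `stateOf_const_smul'` — the state of a difference / multiple of honest fields;
* `ModelFrame.norm_frame_sq` — **the frame-norm identity** `‖S([v] − [Δv])‖² = ∫‖v‖² + ‖∇v‖₂²` for honest `v`
  (modewise: `⟪b i, S([v] − [Δv])⟫ = (1 + m i)^{1/2}⟪b i, [v]⟫`, Parseval on the Hilbert basis, and Green's identity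
  `⟪[v], [Δv]⟫ = ∫⟪v, Δv⟫ = −‖∇v‖₂²`), and its difference form `ModelFrame.norm_frame_sub_sq`;
* `ModelFrame.hasDerivAt_frameCurve` — the explicit frame curve `s ↦ S([u s] − [Δu s])` of a classical solution on
  `[a, b]` is differentiable at interior times with derivative the frame of `∂ₜu` (A3a's `hasDerivWithinAt_stateOf` for
  `u` and `Δu`), and `ModelFrame.continuousOn_frameDerivCurve` — the frame curve of `∂ₜu` is continuous on `[a, b]`.

References: P. Constantin, C. Foias, *Navier–Stokes Equations* (1988), Ch. 4 (4.11)–(4.13) (`(1 + A)^{±1/2}`,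
`‖v‖²_V = ‖v‖² + ‖A^{1/2}v‖²`), Ch. 5 (5.9)–(5.10).  Nothing is asserted; no definition is added.
-/

set_option linter.dupNamespace false

noncomputable section

open Set Function MeasureTheory Filter
open scoped InnerProductSpace RealInnerProductSpace Topology

namespace Summit.AnomalousDissipation.AnomalousDissipation.Theorems.DenseLoudDesignerForces.Ergodic

open Literature.Analysis.FunctionSpaces Literature.Analysis.FunctionSpaces.Torus
open Literature.Analysis.FluidPDE Literature.Analysis.FluidPDE.Torus

/-! ## States of differences and multiples of honest fields -/

section States

variable {v w : (UnitAddTorus (Fin 3)) → (EuclideanSpace ℝ (Fin 3))}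

/-- The difference of two honest fields is honest (smooth, divergence free, mean zero). [folklore] -/
theorem honest_sub (hv : IsSmooth v) (hvd : IsDivFree v) (hvm : HasZeroMean v) (hw : IsSmooth w) (hwd : IsDivFree w)
    (hwm : HasZeroMean w) :
    IsSmooth (fun x => v x - w x) ∧ IsDivFree (fun x => v x - w x) ∧ HasZeroMean (fun x => v x - w x) := by
  refine ⟨hv.sub hw, fun x => ?_, ?_⟩
  · rw [show (fun x => v x - w x) = v - w from rfl, divergence_sub (hv.isContDiff (by simp)) (hw.isContDiff (by simp)),
      hvd x, hwd x, sub_zero]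
  · show ∫ x, (v x - w x) = 0
    rw [integral_sub hv.integrable hw.integrable, hvm, hwm, sub_zero]

/-- A real multiple of an honest field is honest. [folklore] -/
theorem honest_const_smul (hv : IsSmooth v) (hvd : IsDivFree v) (hvm : HasZeroMean v) (c : ℝ) :
    IsSmooth (fun x => c • v x) ∧ IsDivFree (fun x => c • v x) ∧ HasZeroMean (fun x => c • v x) := by
  have hs : IsSmooth (fun x => c • v x) := hv.smul c
  refine ⟨hs, fun x => ?_, ?_⟩
  · have hpd : ∀ i, Torus.partialDeriv i (fun x => c • v x) x = c • Torus.partialDeriv i v x := fun i => by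
      rw [show (fun x => c • v x) = c • v from rfl, partialDeriv_const_smul (hv.isContDiff (by simp)) c]; rfl
    have h0 := hvd x
    rw [divergence_eq_sum_partialDeriv_apply (hv.isContDiff (by simp))] at h0
    rw [divergence_eq_sum_partialDeriv_apply (hs.isContDiff (by simp))]
    simp only [hpd, PiLp.smul_apply, smul_eq_mul, ← Finset.mul_sum, h0, mul_zero]
  · show ∫ x, c • v x = 0
    rw [integral_smul, hvm, smul_zero]

/-- **The state of a difference of honest fields**: `[v − w] = [v] − [w]`. [folklore] -/
theorem stateOf_sub' (hv : IsSmooth v) (hvd : IsDivFree v) (hvm : HasZeroMean v) (hw : IsSmooth w) (hwd : IsDivFree w)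
    (hwm : HasZeroMean w) : stateOf (fun x => v x - w x) = stateOf v - stateOf w := by
  obtain ⟨hs, hd, hm⟩ := honest_sub hv hvd hvm hw hwd hwm
  apply Subtype.ext
  rw [Submodule.coe_sub]
  apply Lp.ext
  have h1 := rep_stateOf hs hd hm
  have h2 := rep_stateOf hv hvd hvm
  have h3 := rep_stateOf hw hwd hwm
  unfold rep at h1 h2 h3
  filter_upwards [h1, h2, h3, Lp.coeFn_sub ((stateOf v : Hsp) : Lp (EuclideanSpace ℝ (Fin 3)) 2 (volume : Measure (UnitAddTorus (Fin 3))))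
    ((stateOf w : Hsp) : Lp (EuclideanSpace ℝ (Fin 3)) 2 (volume : Measure (UnitAddTorus (Fin 3))))] with x e1 e2 e3 e4
  rw [e4, Pi.sub_apply, e1, e2, e3]

/-- **The state of a multiple of an honest field**: `[c • v] = c • [v]`. [folklore] -/
theorem stateOf_const_smul' (hv : IsSmooth v) (hvd : IsDivFree v) (hvm : HasZeroMean v) (c : ℝ) :
    stateOf (fun x => c • v x) = c • stateOf v := by
  obtain ⟨hs, hd, hm⟩ := honest_const_smul hv hvd hvm c
  apply Subtype.ext
  rw [Submodule.coe_smul]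
  apply Lp.ext
  have h1 := rep_stateOf hs hd hm
  have h2 := rep_stateOf hv hvd hvm
  unfold rep at h1 h2
  filter_upwards [h1, h2, Lp.coeFn_smul c ((stateOf v : Hsp) : Lp (EuclideanSpace ℝ (Fin 3)) 2 (volume : Measure (UnitAddTorus (Fin 3))))]
    with x e1 e2 e4
  rw [e4, Pi.smul_apply, e1, e2]

/-- `‖[v] − y‖² = ∫‖v − rep y‖²` for an honest `v` and a state `y`. [folklore] -/
theorem norm_stateOf_sub_sq' (hv : IsSmooth v) (hvd : IsDivFree v) (hvm : HasZeroMean v) (y : Hsp) :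
    ‖stateOf v - y‖ ^ 2 = ∫ x, ‖v x - rep y x‖ ^ 2 := by
  refine stub_trajectoryPowerBudget_aux_norm_sq _ ?_
  have h1 : rep (stateOf v - y) =ᵐ[volume] fun x => rep (stateOf v) x - rep y x := by
    show (((stateOf v - y : Hsp) : Lp (EuclideanSpace ℝ (Fin 3)) 2 (volume : Measure (UnitAddTorus (Fin 3)))) :
        (UnitAddTorus (Fin 3)) → (EuclideanSpace ℝ (Fin 3))) =ᵐ[volume] _
    rw [Submodule.coe_sub]
    exact Lp.coeFn_sub _ _
  filter_upwards [h1, rep_stateOf hv hvd hvm] with x e1 e2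
  rw [e1, e2]

end States

/-! ## The frame-norm identity -/

namespace ModelFrame

variable (F : ModelFrame)

/-- **The frame-norm identity** `‖S([v] − [Δv])‖² = ∫‖v‖² + ‖∇v‖₂²` for the frame `S = (1 + A)^{-1/2}` of a model frame and an
honest field `v` (Constantin–Foias 1988, Ch. 4 (4.11)–(4.13): `‖S⁻¹[v]‖² = ‖(1 + A)^{1/2}[v]‖² = ‖v‖² + ‖∇v‖²`).  Modewise
`⟪b i, S([v] − [Δv])⟫ = (1 + m i)^{-1/2}(1 + m i)⟪b i, [v]⟫`, so by Parseval on the Hilbert basis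
`‖S([v] − [Δv])‖² = ∑ (1 + m i)⟪b i, [v]⟫² = ⟪[v], [v]⟫ − ⟪[v], [Δv]⟫ = ∫‖v‖² − ∫⟪v, Δv⟫`. [folklore] -/
theorem norm_frame_sq {v : (UnitAddTorus (Fin 3)) → (EuclideanSpace ℝ (Fin 3))} (hv : IsSmooth v) (hvd : IsDivFree v)
    (hvm : HasZeroMean v) :
    ‖F.S (stateOf v - stateOf (laplacian v))‖ ^ 2 = (∫ x, ‖v x‖ ^ 2) + gradNormSq v := by
  obtain ⟨hΔ, hΔd, hΔm⟩ : IsSmooth (laplacian v) ∧ IsDivFree (laplacian v) ∧ HasZeroMean (laplacian v) :=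
    ⟨hv.laplacian, IsDivFree.laplacian_of_isSmooth hv hvd, integral_laplacian_eq_zero_of_isSmooth hv⟩
  set y : Hsp := F.S (stateOf v - stateOf (laplacian v)) with hy
  -- termwise identity of the Parseval series
  have hterm : ∀ i, ⟪y, F.b i⟫_ℝ * ⟪F.b i, y⟫_ℝ =
      ⟪stateOf v, F.b i⟫_ℝ * ⟪F.b i, stateOf v⟫_ℝ - ⟪stateOf v, F.b i⟫_ℝ * ⟪F.b i, stateOf (laplacian v)⟫_ℝ := by
    intro i
    obtain ⟨k, a, c, -, -, -, hbi, hmi⟩ := F.hmodes i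
    have h1 : 0 < 1 + F.m i := by linarith [F.hpos i]
    have hcoef : ⟪F.b i, y⟫_ℝ = (1 + F.m i) ^ (-(1 / 2 : ℝ)) * ((1 + F.m i) * ⟪F.b i, stateOf v⟫_ℝ) := by
      rw [hy, inner_basis_apply_of_apply_basis F.b F.hS, inner_sub_right, inner_stateOf_right_of_coe_eq hv hvd hvm hbi,
        inner_stateOf_laplacian_right_of_coe_eq hv hvd hbi, ← hmi]
      ring
    have hlap : ⟪F.b i, stateOf (laplacian v)⟫_ℝ = -(F.m i * ⟪F.b i, stateOf v⟫_ℝ) := by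
      rw [inner_stateOf_laplacian_right_of_coe_eq hv hvd hbi, inner_stateOf_right_of_coe_eq hv hvd hvm hbi, ← hmi]
    have hsq : ((1 + F.m i) ^ (-(1 / 2 : ℝ))) ^ 2 * (1 + F.m i) = 1 := by
      rw [← Real.rpow_natCast, ← Real.rpow_mul h1.le, show (-(1 / 2 : ℝ)) * ((2 : ℕ) : ℝ) = -1 by norm_num,
        Real.rpow_neg_one, inv_mul_cancel₀ h1.ne']
    rw [real_inner_comm (F.b i) y, real_inner_comm (F.b i) (stateOf v), hcoef, hlap]
    linear_combination ((1 + F.m i) * ⟪F.b i, stateOf v⟫_ℝ ^ 2) * hsq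
  have hP1 := F.b.hasSum_inner_mul_inner y y
  have hP2 := (F.b.hasSum_inner_mul_inner (stateOf v) (stateOf v)).sub
    (F.b.hasSum_inner_mul_inner (stateOf v) (stateOf (laplacian v)))
  have heq : ⟪y, y⟫_ℝ = ⟪stateOf v, stateOf v⟫_ℝ - ⟪stateOf v, stateOf (laplacian v)⟫_ℝ :=
    hP1.unique (by simpa only [hterm] using hP2)
  rw [← real_inner_self_eq_norm_sq, heq, real_inner_self_eq_norm_sq, norm_stateOf_sq hv hvd hvm,
    inner_stateOf_left hv hvd hvm]
  have hint : ∫ x, ⟪v x, rep (stateOf (laplacian v)) x⟫_ℝ = ∫ x, ⟪laplacian v x, v x⟫_ℝ := by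
    refine integral_congr_ae ?_
    filter_upwards [rep_stateOf hΔ hΔd hΔm] with x hx
    rw [hx, real_inner_comm]
  rw [hint, integral_inner_laplacian_self_eq_neg_gradNormSq_of_isSmooth hv]
  ring

/-- **Difference form of the frame-norm identity**: `‖S([v] − [Δv]) − S([w] − [Δw])‖² = ∫‖v − w‖² + ‖∇(v − w)‖₂²` for honest
`v, w`. [folklore] -/
theorem norm_frame_sub_sq {v w : (UnitAddTorus (Fin 3)) → (EuclideanSpace ℝ (Fin 3))} (hv : IsSmooth v) (hvd : IsDivFree v)
    (hvm : HasZeroMean v) (hw : IsSmooth w) (hwd : IsDivFree w) (hwm : HasZeroMean w) :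
    ‖F.S (stateOf v - stateOf (laplacian v)) - F.S (stateOf w - stateOf (laplacian w))‖ ^ 2 =
      (∫ x, ‖v x - w x‖ ^ 2) + gradNormSq (fun x => v x - w x) := by
  obtain ⟨hs, hd, hm⟩ := honest_sub hv hvd hvm hw hwd hwm
  have hΔv : IsSmooth (laplacian v) ∧ IsDivFree (laplacian v) ∧ HasZeroMean (laplacian v) :=
    ⟨hv.laplacian, IsDivFree.laplacian_of_isSmooth hv hvd, integral_laplacian_eq_zero_of_isSmooth hv⟩
  have hΔw : IsSmooth (laplacian w) ∧ IsDivFree (laplacian w) ∧ HasZeroMean (laplacian w) :=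
    ⟨hw.laplacian, IsDivFree.laplacian_of_isSmooth hw hwd, integral_laplacian_eq_zero_of_isSmooth hw⟩
  have hL : laplacian (fun x => v x - w x) = fun x => laplacian v x - laplacian w x := by
    rw [show (fun x => v x - w x) = v - w from rfl, laplacian_sub hv hw]
    rfl
  rw [← map_sub, sub_sub_sub_comm, ← stateOf_sub' hv hvd hvm hw hwd hwm,
    ← stateOf_sub' hΔv.1 hΔv.2.1 hΔv.2.2 hΔw.1 hΔw.2.1 hΔw.2.2, ← hL]
  exact F.norm_frame_sq hs hd hm

/-- `‖S([v] − [Δv]) − S([w] − [Δw])‖ ≤ r` as soon as `∫‖v − w‖² + ‖∇(v − w)‖₂² ≤ r²` (`r ≥ 0`). [folklore] -/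
theorem norm_frame_sub_le {v w : (UnitAddTorus (Fin 3)) → (EuclideanSpace ℝ (Fin 3))} (hv : IsSmooth v) (hvd : IsDivFree v)
    (hvm : HasZeroMean v) (hw : IsSmooth w) (hwd : IsDivFree w) (hwm : HasZeroMean w) {r : ℝ} (hr : 0 ≤ r)
    (h : (∫ x, ‖v x - w x‖ ^ 2) + gradNormSq (fun x => v x - w x) ≤ r ^ 2) :
    ‖F.S (stateOf v - stateOf (laplacian v)) - F.S (stateOf w - stateOf (laplacian w))‖ ≤ r := by
  refine (pow_le_pow_iff_left₀ (norm_nonneg _) hr two_ne_zero).1 ?_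
  rwa [F.norm_frame_sub_sq hv hvd hvm hw hwd hwm]

/-! ## The frame curve of a classical solution and of its time derivative -/

/-- **The explicit frame curve of a classical solution is differentiable at interior times, with derivative the frame of
`∂ₜu`**: for a classical solution `(u, p)` on `[a, b] × T³` (`a < b`) with mean-zero slices and `t ∈ (a, b)`,
`s ↦ S([u s] − [Δu s])` has derivative `S([∂ₜu t] − [Δ∂ₜu t])` at `t` (`∂ₜu = timeDerivWithin (Icc a b) u`; the state
curves of the jointly smooth honest fields `u`, `Δu` are differentiable within `[a, b]`, `hasDerivWithinAt_stateOf`, with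
`∂ₜΔu = Δ∂ₜu`, and `[a, b]` is a neighbourhood of `t`). [folklore] -/
theorem hasDerivAt_frameCurve {ν : ℝ} {f : (UnitAddTorus (Fin 3)) → (EuclideanSpace ℝ (Fin 3))} {a b : ℝ} (hab : a < b)
    {u : ℝ → (UnitAddTorus (Fin 3)) → (EuclideanSpace ℝ (Fin 3))} {p : ℝ → (UnitAddTorus (Fin 3)) → ℝ}
    (hsol : IsClassicalNSSolutionOn (Icc a b) ν (fun _ => f) u p) (hmean : ∀ s ∈ Icc a b, HasZeroMean (u s))
    {t : ℝ} (ht : t ∈ Ioo a b) :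
    HasDerivAt (fun s => F.S (stateOf (u s) - stateOf (laplacian (u s))))
      (F.S (stateOf (Torus.timeDerivWithin (Icc a b) u t) - stateOf (laplacian (Torus.timeDerivWithin (Icc a b) u t)))) t := by
  have hU : UniqueDiffOn ℝ (Icc a b) := uniqueDiffOn_Icc hab
  have hu : IsSmoothSpaceTimeOn (Icc a b) u := hsol.smooth_velocity
  have hus : ∀ s ∈ Icc a b, IsSmooth (u s) := fun s hs => hu.isSmooth_slice hs
  have ht' : t ∈ Icc a b := Ioo_subset_Icc_self ht
  have hΔ : IsSmoothSpaceTimeOn (Icc a b) (fun s => laplacian (u s)) := hu.laplacian hU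
  have hΔd : ∀ s ∈ Icc a b, IsDivFree (laplacian (u s)) := fun s hs =>
    IsDivFree.laplacian_of_isSmooth (hus s hs) (hsol.divFree s hs)
  have hΔm : ∀ s ∈ Icc a b, HasZeroMean (laplacian (u s)) := fun s hs => integral_laplacian_eq_zero_of_isSmooth (hus s hs)
  have h1 := hasDerivWithinAt_stateOf hab hu hsol.divFree hmean ht'
  have h2 := hasDerivWithinAt_stateOf hab hΔ hΔd hΔm ht'
  have hΔw : Torus.timeDerivWithin (Icc a b) (fun s => laplacian (u s)) t = laplacian (Torus.timeDerivWithin (Icc a b) u t) :=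
    funext fun x => timeDerivWithin_laplacian_comm hab hu ht' x
  rw [hΔw] at h2
  have h3 := F.S.hasFDerivAt.comp_hasDerivWithinAt t (h1.sub h2)
  rw [map_sub] at h3 ⊢
  exact h3.hasDerivAt (Icc_mem_nhds ht.1 ht.2)

/-- **The frame curve of `∂ₜu` is continuous on the window**: for a classical solution on `[a, b] × T³` (`a < b`) with
mean-zero slices, `s ↦ S([∂ₜu s] − [Δ∂ₜu s])` is continuous on `[a, b]` (`∂ₜu` is jointly smooth with divergence-free
mean-zero slices, so are `Δ∂ₜu`; their state curves are continuous, `continuousOn_stateOf_of_isSmoothSpaceTimeOn`). [folklore] -/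
theorem continuousOn_frameDerivCurve {ν : ℝ} {f : (UnitAddTorus (Fin 3)) → (EuclideanSpace ℝ (Fin 3))} {a b : ℝ} (hab : a < b)
    {u : ℝ → (UnitAddTorus (Fin 3)) → (EuclideanSpace ℝ (Fin 3))} {p : ℝ → (UnitAddTorus (Fin 3)) → ℝ}
    (hsol : IsClassicalNSSolutionOn (Icc a b) ν (fun _ => f) u p) (hmean : ∀ s ∈ Icc a b, HasZeroMean (u s)) :
    ContinuousOn (fun s => F.S (stateOf (Torus.timeDerivWithin (Icc a b) u s) -
      stateOf (laplacian (Torus.timeDerivWithin (Icc a b) u s)))) (Icc a b) := by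
  have hU : UniqueDiffOn ℝ (Icc a b) := uniqueDiffOn_Icc hab
  have hu : IsSmoothSpaceTimeOn (Icc a b) u := hsol.smooth_velocity
  have hw : IsSmoothSpaceTimeOn (Icc a b) (Torus.timeDerivWithin (Icc a b) u) := hu.timeDerivWithin hU
  have hwd : ∀ s ∈ Icc a b, IsDivFree (Torus.timeDerivWithin (Icc a b) u s) := fun s hs =>
    hsol.isDivFree_timeDerivWithin hab hs
  have hwm : ∀ s ∈ Icc a b, HasZeroMean (Torus.timeDerivWithin (Icc a b) u s) := fun s hs =>
    hu.hasZeroMean_timeDerivWithin hab hmean hs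
  have hws : ∀ s ∈ Icc a b, IsSmooth (Torus.timeDerivWithin (Icc a b) u s) := fun s hs => hw.isSmooth_slice hs
  have hΔ : IsSmoothSpaceTimeOn (Icc a b) (fun s => laplacian (Torus.timeDerivWithin (Icc a b) u s)) := hw.laplacian hU
  have hΔd : ∀ s ∈ Icc a b, IsDivFree (laplacian (Torus.timeDerivWithin (Icc a b) u s)) := fun s hs =>
    IsDivFree.laplacian_of_isSmooth (hws s hs) (hwd s hs)
  have hΔm : ∀ s ∈ Icc a b, HasZeroMean (laplacian (Torus.timeDerivWithin (Icc a b) u s)) := fun s hs =>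
    integral_laplacian_eq_zero_of_isSmooth (hws s hs)
  exact F.S.continuous.comp_continuousOn
    ((continuousOn_stateOf_of_isSmoothSpaceTimeOn hw hwd hwm).sub (continuousOn_stateOf_of_isSmoothSpaceTimeOn hΔ hΔd hΔm))

end ModelFrame

end Summit.AnomalousDissipation.AnomalousDissipation.Theorems.DenseLoudDesignerForces.Ergodic

end
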